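import Literature.AlgebraicGeometry.AbelianSchemes.AbelianSchemeConstSubgroupQuotient
import Literature.AlgebraicGeometry.RelativeSpec.ActionOverPullback
import Literature.AlgebraicGeometry.RelativeSpec.GeometricQuotientGroupLaw
import Literature.AlgebraicGeometry.RelativeSpec.GeometricQuotientFreeEquivariantDescent
import HarnessLib

/-!
# The translation action on `A ×_S T′` through the first factor, over `ψ × 1 : A ×_S T′ → (A/K) ×_S T′`
# — «the quotient `A → A/K` stays a free quotient after base change» (HECKE-LINK file (ii), brick (u0);
# Mumford, *Abelian Varieties* §7 Thm. 4, §12 Thm. 1; SGA 1 V §1)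

Let `A` be an abelian scheme over `S → Y` (`Y` affine for the quotient theorems), `K ⊆ A(S)` a finite group of
sections acting by translations (★ `AbelianSchemeConstSubgroupQuotient`: `translation`, `translationActionOver`,
`quotientMk =: ψ : A → A/K`, `quotientActionOver`), and `T′ : Over S` ANY `S`-scheme (a test object `T → S`).
On `A ×_S T′ = (A.X ⊗ T′).left` the group `K` acts by `t_σ × 1`, and the base-changed quotient map is
`ψ × 1 = (ψ ▷ T′).left : A ×_S T′ → (A/K) ×_S T′` (Mathlib `Over.whiskerRight_left`; its `.left` is the tree's
`baseChangeHom ψ f` for `T′ = Over.mk f` up to the `Over.pullback = ⊗` bookkeeping). This file is the mirror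
image of ★ `AbelianSchemeQuotientDualSideAction` (brick D3a, second factor) and supplies the inputs
`(ρ′) (hq) [IsAffineHom] (hfree)` of the tree's equivariant-descent theorems (★ `exists_descent_of_free`,
`descent_unique_of_free`, `moduleInvariants`, ★ `isPullback_of_equivariant_of_free`) for `ψ × 1`:

* `translationActionOverWhiskerRight A T′ u K hcov : ActionOver (A.quotientMk u K hcov ▷ T′).left K` — THE ONE
  CONSTRUCTION (★ `ActionOver.onPullback` with the translation action on `A` and the trivial actions on `T′`, `S`);
  `…_aut_hom : (… .aut σ).hom = (A.translation σ ▷ T′).left` (`rfl`), `…_aut_hom_fst` (`≫ pr_A = pr_A ≫ t_σ`),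
  `…_aut_hom_snd` (`≫ pr_T = pr_T`);
* `isAffineHom_/isFinite_/surjective_whiskerRight_quotientMk_left` — `ψ × 1` is a base change of `ψ`
  (★ `IsGeometricQuotient.isPullback_whiskerRight_left`);
* **`isGeometricQuotient_translationActionOverWhiskerRight`** — `ψ × 1` is a geometric quotient for `t_• × 1`
  (★ `isGeometricQuotient_baseChange_of_free`: free quotients commute with EVERY base change);
* **`translationActionOverWhiskerRight_free`** — `t_• × 1` is free in the ring form on the charts of `(A/K) ×_S T′`
  (★ `IsGeometricQuotient.free_of_equivariant` along the equivariant `pr_A`).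

All `def`s are constructions with bodies; no named facts.

## References

* D. Mumford, *Abelian Varieties* (1970), §7 Thm. 4 (p. 72), §12 Thm. 1 (p. 111). [MumfordAV1970]
* A. Grothendieck, *SGA 1*, Exp. V §1 (Prop. 1.9), Prop. 2.6, Déf. 2.7. [SGA1]
-/

noncomputable section

universe u

open CategoryTheory CategoryTheory.Limits AlgebraicGeometry MonoidalCategory CartesianMonoidalCategory
open scoped MonObj

namespace Literature.AlgebraicGeometry.AbelianSchemes.AbelianSchemeOver

open Literature.AlgebraicGeometry.RelativeSpec

variable {S : Scheme.{u}} (A : AbelianSchemeOver S) (T' : Over S) {Y : Scheme.{u}} (u : S ⟶ Y) (K : Subgroup A.Sections)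

/-- `t_σ.left ≫ (A → S) = (A → S)` against the trivial action on `S`. [folklore] -/
private theorem compat_fst (σ : K) :
    ((A.translationActionOver u K).aut σ).hom ≫ A.X.hom = A.X.hom ≫ ((1 : K →* Aut S) σ).hom :=
  (A.aut_hom_comp_hom u K σ).trans (Category.comp_id _).symm

/-- The trivial actions on `T′` and on `S` are compatible with `T′ → S`. [folklore] -/
private theorem compat_snd (σ : K) :
    ((1 : K →* Aut T'.left) σ).hom ≫ T'.hom = T'.hom ≫ ((1 : K →* Aut S) σ).hom :=
  (Category.id_comp _).trans (Category.comp_id _).symm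

variable [Finite K] [Y.IsSeparated] [IsSeparated (A.X.hom ≫ u)] [S.IsSeparated]
  (hcov : ∀ x : A.left, ∃ O : (A.translationActionOver u K).StableAffineOpens, x ∈ O.1)

/-- **The `K`-action `t_• × 1` on `A ×_S T′`, over `ψ × 1 : A ×_S T′ → (A/K) ×_S T′`** (★ `ActionOver.onPullback`
with the translation action on `A` and the trivial actions on `T′`, `S`; `t_σ × 1` commutes with `ψ × 1` because
`t_σ ≫ ψ = ψ`). [cite: MumfordAV1970, §7 Thm. 4 (p. 72)] -/
def translationActionOverWhiskerRight : ActionOver (A.quotientMk u K hcov ▷ T').left K :=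
  ActionOver.onPullback A.X.hom T'.hom (A.translationActionOver u K).aut (1 : K →* Aut T'.left)
    (1 : K →* Aut S) (compat_fst A u K) (compat_snd A T' K) (A.quotientMk u K hcov ▷ T').left fun σ => by
      change (A.translation (σ : A.Sections) ▷ T').left ≫ _ = _
      rw [← Over.comp_left, ← comp_whiskerRight, A.translation_comp_quotientMk]

/-- **`t_σ × 1` is the whiskering `t_σ ▷ T′`** (definitionally; Mathlib `Over.whiskerRight_left` gives the
`pullback.map _ _ _ _ (t_σ).left (𝟙 _) (𝟙 S) _ _` form). [cite: MumfordAV1970, §7 Thm. 4 (p. 72)] -/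
theorem translationActionOverWhiskerRight_aut_hom (σ : K) :
    ((translationActionOverWhiskerRight A T' u K hcov).aut σ).hom = (A.translation (σ : A.Sections) ▷ T').left :=
  rfl

/-- `(t_σ × 1) ≫ pr_A = pr_A ≫ t_σ`. [cite: MumfordAV1970, §7 Thm. 4 (p. 72)] -/
theorem translationActionOverWhiskerRight_aut_hom_fst (σ : K) :
    ((translationActionOverWhiskerRight A T' u K hcov).aut σ).hom ≫ pullback.fst A.X.hom T'.hom =
      pullback.fst A.X.hom T'.hom ≫ (A.translation (σ : A.Sections)).left := by
  rw [translationActionOverWhiskerRight_aut_hom]; exact Over.whiskerRight_left_fst _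

/-- `(t_σ × 1) ≫ pr_T = pr_T`. [cite: MumfordAV1970, §7 Thm. 4 (p. 72)] -/
theorem translationActionOverWhiskerRight_aut_hom_snd (σ : K) :
    ((translationActionOverWhiskerRight A T' u K hcov).aut σ).hom ≫ pullback.snd A.X.hom T'.hom =
      pullback.snd A.X.hom T'.hom := by
  rw [translationActionOverWhiskerRight_aut_hom]; exact Over.whiskerRight_left_snd _

/-- `ψ × 1` is affine (a base change of the affine `ψ`, ★ `isPullback_whiskerRight_left`).
[cite: MumfordAV1970, §7 Thm. 4 (p. 72)] -/
theorem isAffineHom_whiskerRight_quotientMk_left : IsAffineHom (A.quotientMk u K hcov ▷ T').left :=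
  haveI := A.isAffineHom_quotientMk_left u K hcov
  MorphismProperty.of_isPullback
    (ActionOver.IsGeometricQuotient.isPullback_whiskerRight_left (A.quotientMk u K hcov) T') ‹_›

/-- `ψ × 1` is finite (base change of the finite `ψ`). [cite: MumfordAV1970, §7 Thm. 4 (p. 72)] -/
theorem isFinite_whiskerRight_quotientMk_left [LocallyOfFiniteType (A.X.hom ≫ u)] :
    IsFinite (A.quotientMk u K hcov ▷ T').left :=
  haveI := A.isFinite_quotientMk_left u K hcov
  MorphismProperty.of_isPullback
    (ActionOver.IsGeometricQuotient.isPullback_whiskerRight_left (A.quotientMk u K hcov) T') ‹_›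

/-- `ψ × 1` is surjective (base change of the surjective `ψ`). [cite: MumfordAV1970, §7 Thm. 4 (p. 72)] -/
theorem surjective_whiskerRight_quotientMk_left : Surjective (A.quotientMk u K hcov ▷ T').left :=
  haveI : Surjective (A.quotientMk u K hcov).left := ⟨A.quotientMk_left_surjective u K hcov⟩
  MorphismProperty.of_isPullback
    (ActionOver.IsGeometricQuotient.isPullback_whiskerRight_left (A.quotientMk u K hcov) T') ‹_›

/-- **`ψ × 1 : A ×_S T′ → (A/K) ×_S T′` is a geometric quotient for the action `t_• × 1`** (`Y` affine, `K` acting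
without fixed geometric points): `ψ` is a FREE affine geometric quotient (★ `isGeometricQuotient_quotientActionOver`,
`quotientActionOver_free`) and free quotients commute with every base change (★ `isGeometricQuotient_baseChange_of_free`
on the square ★ `isPullback_whiskerRight_left`) — «the formation of `A/K` commutes with base change».
[cite: MumfordAV1970, §7 Thm. 4 (p. 72)] [cite: SGA1, Exp. V §1, Prop. 1.9] -/
theorem isGeometricQuotient_translationActionOverWhiskerRight [IsAffine Y]
    (hfree : ∀ (Ω : Type u) [Field Ω] [IsAlgClosed Ω] (x : Spec (.of Ω) ⟶ A.left) (σ : K), σ ≠ 1 →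
      x ≫ (A.translation (σ : A.Sections)).left ≠ x) :
    (translationActionOverWhiskerRight A T' u K hcov).IsGeometricQuotient (A.quotientMk u K hcov ▷ T').left := by
  haveI : Fintype K := Fintype.ofFinite K
  haveI := A.isAffineHom_quotientMk_left u K hcov
  exact (A.isGeometricQuotient_quotientActionOver u K hcov).isGeometricQuotient_baseChange_of_free
    (A.quotientActionOver_free u K hcov hfree)
    (ActionOver.IsGeometricQuotient.isPullback_whiskerRight_left (A.quotientMk u K hcov) T')
    (translationActionOverWhiskerRight A T' u K hcov) fun σ =>
      translationActionOverWhiskerRight_aut_hom_fst A T' u K hcov σ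

/-- **The action `t_• × 1` on `A ×_S T′` is FREE** (ring form on the affine charts of `(A/K) ×_S T′`): it covers the free
translation action on `A` along the equivariant `pr_A` (★ `IsGeometricQuotient.free_of_equivariant`).
[cite: SGA1, Exp. V Prop. 2.6 (i), Déf. 2.7] -/
theorem translationActionOverWhiskerRight_free
    (hfree : ∀ (Ω : Type u) [Field Ω] [IsAlgClosed Ω] (x : Spec (.of Ω) ⟶ A.left) (σ : K), σ ≠ 1 →
      x ≫ (A.translation (σ : A.Sections)).left ≠ x) :
    ∀ (V : (A.quotientOver u K ⊗ T').left.Opens), IsAffineOpen V → ∀ σ : K, σ ≠ 1 →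
      Ideal.span (Set.range fun b : Γ((A.X ⊗ T').left, (A.quotientMk u K hcov ▷ T').left ⁻¹ᵁ V) ↦
        (translationActionOverWhiskerRight A T' u K hcov).act σ V b - b) = ⊤ := by
  haveI := A.isAffineHom_quotientMk_left u K hcov
  haveI := isAffineHom_whiskerRight_quotientMk_left A T' u K hcov
  exact ActionOver.IsGeometricQuotient.free_of_equivariant (A.quotientActionOver_free u K hcov hfree)
    (translationActionOverWhiskerRight A T' u K hcov) (pullback.fst A.X.hom T'.hom) fun σ =>
      translationActionOverWhiskerRight_aut_hom_fst A T' u K hcov σ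

end Literature.AlgebraicGeometry.AbelianSchemes.AbelianSchemeOver

end
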